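import Mathlib
import Literature.Computability.Complexity.MCSPHardnessKabanetsCaiProofs
import Summits.ValiantsHypothesis.ValiantsHypothesis.Theorems.BarrierLeverDefinableEquationsPartialDerivativeWallAllOrders

/-!
# Route BarrierLever — method wall #1c, part 3: EVERY FIXED CELL `(k, τ)` of the shifted-partials
# chart is walled INSIDE THE OPEN RUNG `SmallCircuits ℂ n 2` — indeed inside size
# `2k·n·(⌊log₂ n⌋ + 1)` — once `n ≥ max(k(τ + 2k), (2k+2)²)` (crux `DefinableEquations`
# stmt-8745 / item `SingleSizeEquations` stmt-8749; val-np-p5 g13)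

Part 2 (`…AllOrders.lean`): `W_{k,e} = Σ_{j<k} (Σ_i x_i^{e+j+1})^k` attains the universal
ceiling of the order-`k` shift-`τ` shifted-partials measure for `e ≥ τ + k`.  This file prices the
witness and states the wall.

* COST (`complexity_powerSumPowers_le`, `…_le'`): `L(W_{k,e}) ≤ k(n(2⌊log₂(e+k)⌋+1) + 2⌊log₂ k⌋) + k
  ≤ 2k·n·(⌊log₂ n⌋ + 1)` for `n ≥ 6`, `k(e+k) ≤ n` (binary powering with sharing,
  `complexity_pow_le_add_two_mul_log`; one addition per summand); `deg W_{k,e} ≤ k(e+k)`.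
* MEMBERSHIP (`powerSumPowers_mem_smallCircuits`): `W_{k,e} ∈ SmallCircuits ℂ n b` for every
  `b ≥ 2` when `n ≥ 6`, `k(e+k) ≤ n`, `2k(⌊log₂ n⌋+1) ≤ n`.
* THE WALL (`no_shiftedRankMethod_smallCircuits_allOrders`, `…_cell` with `e = τ + k`): under
  these side conditions there is no threshold `r` with `rank f_{(k,·)[τ]} < r` on
  `SmallCircuits ℂ n b` (`b ≥ 2`) and `rank g_{(k,·)[τ]} ≥ r` for some polynomial `g` — whatever
  `g` is; `sublevel_eq_univ_of_smallCircuits_allOrders` (a threshold set containing the class is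
  everything); the `O(k n log n)`-size form `no_shiftedRankMethod_knlogn`.
* EVENTUALLY (`no_shiftedRankMethod_smallCircuits_eventually`): for every `k ≥ 1` and `τ` there
  is `n₀ = max(k(τ+2k), (2k+2)²)` beyond which the cell `(k, τ)` is closed at every `b ≥ 2`
  (`⌊log₂ n⌋ ≤ ⌊√n⌋` for `n ≥ 16`, `log_two_le_sqrt`, via the tree's `KabanetsCai.sq_le_two_pow`).

READING FOR THE CHART (LANDSCAPE-8749-g10…g13): with g10 (shift `0`, orders `≤ ⌊n/2⌋`; orders
`≥ ⌊n/2⌋` among homogeneous targets) and g11/g12 (order `1`, every shift) the kernel now says: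
the only part of the shifted-partials method NOT walled at the open rung `b = 2` is the regime
in which the order or the shift GROWS with `n` so that `k(τ + 2k) > n` — the
Gupta–Kamath–Kayal–Saptharishi regime proper (`k ≈ √n`, large shifts), where the ceiling
`#ops` is no longer the generic value and an honest wall needs the exact generic rank
(Fröberg-type).  The g12 census frontier cells `(4,2)`, `(5,1)` at `n = 9, 10` lie below the
thresholds `k(τ+2k) = 40, 55` of this theorem (numerically a single level `(Σ x_i^e)^k` already
saturates `(k,τ)` for `τ ≤ e - 2`, i.e. from `n ≥ k(τ+2)`: 16 resp. 15).

Honest scope: a METHOD WALL; the crux / item are untouched (b = 2 OPEN, Chatterjee–Tengse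
arXiv:2309.07612 §1.3 dir. 2); nothing bears on `VP ≠ VNP`.  No definitions, no named facts;
standard axioms.  Refs: Forbes–Shpilka–Volk 2018 Cor. 5 (classes); Gesmundo–Landsberg 2019
Thm. 4 / §1; Bürgisser 2000 §2.1.
-/

-- `Summit.ValiantsHypothesis.ValiantsHypothesis.…` repeats a component by the D-0017 layout
-- (single-conjunct summit), which the `dupNamespace` linter flags; the name is mandated.
set_option linter.dupNamespace false

noncomputable section

namespace Summit.ValiantsHypothesis.ValiantsHypothesis.Theorems.BarrierLeverDefinableEquations

open MvPolynomial
open Literature.Computability.AlgebraicComplexity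
open Literature.Barriers.ValiantsHypothesis
open scoped BigOperators

namespace PartialDerivativeWall

section Wall

variable {K : Type*} [Field K] {n : ℕ} {k τ e : ℕ}

/-! ## §1 The witness is cheap (`O(k·n·log n)` gates, degree `k(e+k)`) -/

/-- `W_{k,e} = Σ_{j<k} (Σ_i x_i^{e+j+1})^k` written with explicit powers. [folklore] -/
theorem powerSumPowers_eq (K : Type*) [Field K] (n k e : ℕ) :
    powerSumPowers K n k e = ∑ j : Fin k, (∑ i : Fin n, (X i : MvPolynomial (Fin n) K) ^ (e + j + 1)) ^ k := by
  unfold powerSumPowers linPow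
  refine Finset.sum_congr rfl fun j _ => ?_
  rw [map_pow, map_sum]
  simp_rw [expand_X]

/-- `L((Σ_i x_i^E)^k) ≤ n(2⌊log₂ E⌋ + 1) + 2⌊log₂ k⌋` (binary powering with sharing, one addition
per summand). [cite: Burgisser2000, §2.1] -/
theorem complexity_sumPow_pow_le (E k : ℕ) :
    complexity ((∑ i : Fin n, (X i : MvPolynomial (Fin n) K) ^ E) ^ k) ≤
      n * (2 * Nat.log 2 E + 1) + 2 * Nat.log 2 k := by
  classical
  have hsum : complexity (∑ i : Fin n, (X i : MvPolynomial (Fin n) K) ^ E) ≤ n * (2 * Nat.log 2 E + 1) := by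
    refine (complexity_finset_sum_le _ _).trans ?_
    have h1 : ∀ i : Fin n, complexity ((X i : MvPolynomial (Fin n) K) ^ E) ≤ 2 * Nat.log 2 E := by
      intro i
      have h := complexity_pow_le_add_two_mul_log (X i : MvPolynomial (Fin n) K) E
      rw [complexity_X_holds] at h
      simpa using h
    calc ∑ i : Fin n, complexity ((X i : MvPolynomial (Fin n) K) ^ E) + (Finset.univ : Finset (Fin n)).card
        ≤ ∑ _i : Fin n, 2 * Nat.log 2 E + (Finset.univ : Finset (Fin n)).card :=
          Nat.add_le_add_right (Finset.sum_le_sum fun i _ => h1 i) _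
      _ = n * (2 * Nat.log 2 E + 1) := by simp; ring
  have h := complexity_pow_le_add_two_mul_log (∑ i : Fin n, (X i : MvPolynomial (Fin n) K) ^ E) k
  omega

/-- **Cost of the witness**: `L(W_{k,e}) ≤ k·(n(2⌊log₂(e+k)⌋ + 1) + 2⌊log₂ k⌋) + k`.
[cite: Burgisser2000, §2.1] -/
theorem complexity_powerSumPowers_le (n k e : ℕ) :
    complexity (powerSumPowers K n k e) ≤ k * (n * (2 * Nat.log 2 (e + k) + 1) + 2 * Nat.log 2 k) + k := by
  classical
  rw [powerSumPowers_eq]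
  refine (complexity_finset_sum_le _ _).trans ?_
  have h1 : ∀ j : Fin k, complexity ((∑ i : Fin n, (X i : MvPolynomial (Fin n) K) ^ (e + j + 1)) ^ k) ≤
      n * (2 * Nat.log 2 (e + k) + 1) + 2 * Nat.log 2 k := by
    intro j
    refine (complexity_sumPow_pow_le _ _).trans ?_
    have hlog : Nat.log 2 (e + j + 1) ≤ Nat.log 2 (e + k) := Nat.log_mono_right (by omega)
    nlinarith
  calc ∑ j : Fin k, complexity ((∑ i : Fin n, (X i : MvPolynomial (Fin n) K) ^ (e + (j : ℕ) + 1)) ^ k) +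
        (Finset.univ : Finset (Fin k)).card
      ≤ ∑ _j : Fin k, (n * (2 * Nat.log 2 (e + k) + 1) + 2 * Nat.log 2 k) +
        (Finset.univ : Finset (Fin k)).card :=
          Nat.add_le_add_right (Finset.sum_le_sum fun j _ => h1 j) _
    _ = k * (n * (2 * Nat.log 2 (e + k) + 1) + 2 * Nat.log 2 k) + k := by simp

/-- **Degree of the witness**: `deg W_{k,e} ≤ k(e+k)`. [folklore] -/
theorem totalDegree_powerSumPowers_le (n k e : ℕ) :
    (powerSumPowers K n k e).totalDegree ≤ k * (e + k) := by
  rw [powerSumPowers_eq]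
  refine (totalDegree_finsetSum _ _).trans (Finset.sup_le fun j _ => ?_)
  refine (totalDegree_pow _ _).trans ?_
  have h : (∑ i : Fin n, (X i : MvPolynomial (Fin n) K) ^ (e + (j : ℕ) + 1)).totalDegree ≤ e + k := by
    refine (totalDegree_finsetSum _ _).trans (Finset.sup_le fun i _ => ?_)
    refine (totalDegree_pow _ _).trans ?_
    rw [totalDegree_X, mul_one]
    omega
  exact Nat.mul_le_mul_left k h

/-- A clean sufficient cost bound: for `n ≥ 6`, `k ≥ 1`, `k(e + k) ≤ n`:
`L(W_{k,e}) ≤ 2k·n·(⌊log₂ n⌋ + 1)`. [cite: Burgisser2000, §2.1] -/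
theorem complexity_powerSumPowers_le' (hn : 6 ≤ n) (hk : 1 ≤ k) (hdeg : k * (e + k) ≤ n) :
    complexity (powerSumPowers K n k e) ≤ 2 * k * n * (Nat.log 2 n + 1) := by
  refine (complexity_powerSumPowers_le n k e).trans ?_
  have hek : e + k ≤ n := le_trans (Nat.le_mul_of_pos_left (e + k) hk) hdeg
  have hkn : k ≤ n := le_trans (by nlinarith) hdeg
  have h1 : Nat.log 2 (e + k) ≤ Nat.log 2 n := Nat.log_mono_right hek
  have h2 : Nat.log 2 k ≤ Nat.log 2 n := Nat.log_mono_right hkn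
  have h3 : 2 * Nat.log 2 n + 2 ≤ n := two_mul_log_add_two_le hn
  have h4 : k * (n * (2 * Nat.log 2 (e + k) + 1) + 2 * Nat.log 2 k) + k ≤
      k * (n * (2 * Nat.log 2 n + 1) + 2 * Nat.log 2 n) + k := by
    gcongr
  refine h4.trans ?_
  have h5 : n * (2 * Nat.log 2 n + 1) + 2 * Nat.log 2 n + 1 ≤ 2 * n * (Nat.log 2 n + 1) := by nlinarith
  nlinarith

/-- **The witness lies in the open rung**: for `n ≥ 6`, `k ≥ 1`, `k(e+k) ≤ n` and
`2k(⌊log₂ n⌋ + 1) ≤ n`, `W_{k,e} ∈ SmallCircuits ℂ n b` for every `b ≥ 2`.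
[cite: ForbesShpilkaVolk2018, Cor. 5] -/
theorem powerSumPowers_mem_smallCircuits {b : ℕ} (hb : 2 ≤ b) (hn : 6 ≤ n) (hk : 1 ≤ k)
    (hdeg : k * (e + k) ≤ n) (hcost : 2 * k * (Nat.log 2 n + 1) ≤ n) :
    powerSumPowers ℂ n k e ∈ SmallCircuits ℂ n b := by
  refine ⟨(totalDegree_powerSumPowers_le n k e).trans hdeg, ?_⟩
  refine (complexity_powerSumPowers_le' hn hk hdeg).trans ?_
  calc 2 * k * n * (Nat.log 2 n + 1) = n * (2 * k * (Nat.log 2 n + 1)) := by ring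
    _ ≤ n * n := Nat.mul_le_mul_left n hcost
    _ = n ^ 2 := (sq n).symm
    _ ≤ n ^ b := Nat.pow_le_pow_right (by omega) hb

/-- A threshold set of the order-`k`, shift-`τ` measure containing the class is everything.

/-! ## §2 The wall -/

[cite: GesmundoLandsberg2017, Thm. 4 and §1] -/
theorem sublevel_eq_univ_of_smallCircuits_allOrders {b r : ℕ} (hb : 2 ≤ b) (hn : 6 ≤ n)
    (hk : 1 ≤ k) (he : τ + k ≤ e) (hdeg : k * (e + k) ≤ n) (hcost : 2 * k * (Nat.log 2 n + 1) ≤ n)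
    (h : ∀ f ∈ SmallCircuits ℂ n b, shiftedPartialsRank ℂ k τ f < r) :
    {g : MvPolynomial (Fin n) ℂ | shiftedPartialsRank ℂ k τ g < r} = Set.univ := by
  refine Set.eq_univ_of_forall fun g => ?_
  exact lt_of_le_of_lt (shiftedPartialsRank_le_powerSumPowers hk he g)
    (h _ (powerSumPowers_mem_smallCircuits hb hn hk hdeg hcost))

/-- **No shifted-partials rank method of order `k` and shift `τ` against `SmallCircuits ℂ n b`,
`b ≥ 2`** (`n ≥ 6`, `k ≥ 1`, some `e ≥ τ + k` with `k(e+k) ≤ n`, and `2k(⌊log₂ n⌋ + 1) ≤ n`):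
there is no threshold `r` with `rank f_{(k,·)[τ]} < r` on the class and `rank g_{(k,·)[τ]} ≥ r`
for some polynomial `g` (any degree, homogeneous or not — the ceiling is universal).
[cite: ForbesShpilkaVolk2018, Cor. 5] -/
theorem no_shiftedRankMethod_smallCircuits_allOrders {b : ℕ} (hb : 2 ≤ b) (hn : 6 ≤ n)
    (hk : 1 ≤ k) (he : τ + k ≤ e) (hdeg : k * (e + k) ≤ n) (hcost : 2 * k * (Nat.log 2 n + 1) ≤ n) :
    ¬ ∃ r : ℕ, (∀ f ∈ SmallCircuits ℂ n b, shiftedPartialsRank ℂ k τ f < r) ∧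
      ∃ g : MvPolynomial (Fin n) ℂ, r ≤ shiftedPartialsRank ℂ k τ g := by
  rintro ⟨r, hcls, g, hr⟩
  have hg := (Set.eq_univ_iff_forall.mp
    (sublevel_eq_univ_of_smallCircuits_allOrders hb hn hk he hdeg hcost hcls)) g
  exact absurd hg (not_lt.2 hr)

/-- **The cell `(k, τ)` is closed at the open rung as soon as `n ≥ k(τ + 2k)`** (and
`2k(⌊log₂ n⌋ + 1) ≤ n`, `n ≥ 6`): take `e = τ + k`. [cite: ForbesShpilkaVolk2018, Cor. 5] -/
theorem no_shiftedRankMethod_smallCircuits_cell {b : ℕ} (hb : 2 ≤ b) (hn : 6 ≤ n) (hk : 1 ≤ k)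
    (hcell : k * (τ + 2 * k) ≤ n) (hcost : 2 * k * (Nat.log 2 n + 1) ≤ n) :
    ¬ ∃ r : ℕ, (∀ f ∈ SmallCircuits ℂ n b, shiftedPartialsRank ℂ k τ f < r) ∧
      ∃ g : MvPolynomial (Fin n) ℂ, r ≤ shiftedPartialsRank ℂ k τ g :=
  no_shiftedRankMethod_smallCircuits_allOrders (e := τ + k) hb hn hk le_rfl
    (by rw [show τ + k + k = τ + 2 * k by ring]; exact hcell) hcost

/-- The `O(k·n·log n)`-size form: order-`k`, shift-`τ` shifted partials do not even separate
the class `{deg ≤ n, L ≤ 2k·n·(⌊log₂ n⌋ + 1)}` from anything, for `n ≥ max(6, k(τ + 2k))`.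
[cite: ForbesShpilkaVolk2018, Cor. 5] -/
theorem no_shiftedRankMethod_knlogn {n k τ : ℕ} (hn : 6 ≤ n) (hk : 1 ≤ k)
    (hcell : k * (τ + 2 * k) ≤ n) :
    ¬ ∃ r : ℕ, (∀ f : MvPolynomial (Fin n) ℂ, f.totalDegree ≤ n →
        complexity f ≤ 2 * k * n * (Nat.log 2 n + 1) → shiftedPartialsRank ℂ k τ f < r) ∧
      ∃ g : MvPolynomial (Fin n) ℂ, r ≤ shiftedPartialsRank ℂ k τ g := by
  rintro ⟨r, hcls, g, hr⟩
  have hdeg : k * (τ + k + k) ≤ n := by rw [show τ + k + k = τ + 2 * k by ring]; exact hcell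
  have hW := hcls (powerSumPowers ℂ n k (τ + k))
    ((totalDegree_powerSumPowers_le n k (τ + k)).trans hdeg)
    (complexity_powerSumPowers_le' hn hk hdeg)
  exact absurd ((shiftedPartialsRank_le_powerSumPowers hk le_rfl g).trans_lt hW) (not_lt.2 hr)

/-! ## §8 Every FIXED cell `(k, τ)` is eventually closed -/

/-- `⌊log₂ n⌋ ≤ ⌊√n⌋` for `n ≥ 16`. [folklore] -/
theorem log_two_le_sqrt {n : ℕ} (hn : 16 ≤ n) : Nat.log 2 n ≤ Nat.sqrt n := by
  set s := Nat.sqrt n with hs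
  have h4 : 4 ≤ s := Nat.le_sqrt.mpr (by omega)
  have hlt : n < (s + 1) * (s + 1) := Nat.lt_succ_sqrt n
  have hpow : (s + 1) * (s + 1) ≤ 2 ^ (s + 1) :=
    Literature.Computability.Complexity.KabanetsCai.sq_le_two_pow (by omega)
  have h : Nat.log 2 n < s + 1 :=
    (Nat.log_lt_iff_lt_pow one_lt_two (by omega)).mpr (hlt.trans_le hpow)
  omega

/-- The cost side condition holds for `n ≥ (2k+2)²`. [folklore] -/
theorem two_mul_mul_log_succ_le {n k : ℕ} (hk : 1 ≤ k) (hn : (2 * k + 2) * (2 * k + 2) ≤ n) :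
    2 * k * (Nat.log 2 n + 1) ≤ n := by
  have h16 : 16 ≤ n := le_trans (by nlinarith) hn
  have hlog := log_two_le_sqrt h16
  set s := Nat.sqrt n with hs
  have hs2 : 2 * k + 2 ≤ s := Nat.le_sqrt.mpr hn
  have hss : s * s ≤ n := Nat.sqrt_le n
  calc 2 * k * (Nat.log 2 n + 1) ≤ 2 * k * (s + 1) := Nat.mul_le_mul_left _ (by omega)
    _ ≤ s * s := by nlinarith
    _ ≤ n := hss

/-- **Every fixed cell of the shifted-partials chart is eventually walled at the open rung.**
For every order `k ≥ 1` and shift `τ` there is `n₀` (`= max (k(τ+2k)) (2k+2)²`) such that for all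
`n ≥ n₀` and every `b ≥ 2`, no order-`k` shift-`τ` shifted-partials rank method separates
`SmallCircuits ℂ n b` from any polynomial.  What stays unwalled in the kernel at `b = 2` is only
the regime where `k` or `τ` grows with `n` (`k(τ + 2k) > n`, the Gupta–Kamath–Kayal–Saptharishi
range). [cite: ForbesShpilkaVolk2018, Cor. 5] -/
theorem no_shiftedRankMethod_smallCircuits_eventually {k : ℕ} (hk : 1 ≤ k) (τ : ℕ) :
    ∃ n₀ : ℕ, ∀ n : ℕ, n₀ ≤ n → ∀ b : ℕ, 2 ≤ b →
      ¬ ∃ r : ℕ, (∀ f ∈ SmallCircuits ℂ n b, shiftedPartialsRank ℂ k τ f < r) ∧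
        ∃ g : MvPolynomial (Fin n) ℂ, r ≤ shiftedPartialsRank ℂ k τ g := by
  refine ⟨max (k * (τ + 2 * k)) ((2 * k + 2) * (2 * k + 2)), fun n hn b hb => ?_⟩
  have h1 : k * (τ + 2 * k) ≤ n := le_trans (le_max_left _ _) hn
  have h2 : (2 * k + 2) * (2 * k + 2) ≤ n := le_trans (le_max_right _ _) hn
  have h6 : 6 ≤ n := le_trans (by nlinarith) h2
  exact no_shiftedRankMethod_smallCircuits_cell hb h6 hk h1 (two_mul_mul_log_succ_le hk h2)

end Wall

/-! ## §3 In FSV's vocabulary: no distinguisher of this kind, at any level (appended) -/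

section FSV

/-- **FSV form of the wall.**  A polynomial `D` in the `N = C(2n,n)` coefficient variables whose
zero set on degree-`≤ n` coefficient vectors is an order-`k` shift-`τ` shifted-partials threshold
set `{g : rank g_{(k,·)[τ]} < r}` and which vanishes on `SmallCircuits ℂ n b` (`b ≥ 2`; side
conditions as in `no_shiftedRankMethod_smallCircuits_allOrders`) is the ZERO polynomial.
[cite: ForbesShpilkaVolk2018, Def. 1] -/
theorem distinguisher_eq_zero_of_spRankSublevel {n b k τ e r : ℕ} (hb : 2 ≤ b) (hn : 6 ≤ n)
    (hk : 1 ≤ k) (he : τ + k ≤ e) (hdeg : k * (e + k) ≤ n) (hcost : 2 * k * (Nat.log 2 n + 1) ≤ n)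
    (D : MvPolynomial (degLEMonomials n) ℂ)
    (hD : ∀ f : MvPolynomial (Fin n) ℂ, f.totalDegree ≤ n →
      (eval (coeffVector (degLEMonomials n) f) D = 0 ↔ shiftedPartialsRank ℂ k τ f < r))
    (hvan : ∀ f ∈ SmallCircuits ℂ n b, eval (coeffVector (degLEMonomials n) f) D = 0) :
    D = 0 := by
  have huniv := sublevel_eq_univ_of_smallCircuits_allOrders hb hn hk he hdeg hcost (r := r)
    fun f hf => (hD f hf.1).1 (hvan f hf)
  refine MvPolynomial.funext fun c => ?_
  obtain ⟨f, hfdeg, rfl⟩ := exists_coeffVector_eq c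
  rw [map_zero]
  exact (hD f hfdeg).2 (Set.eq_univ_iff_forall.1 huniv f)

/-- Hence such a `D` is never an FSV natural proof against `SmallCircuits ℂ n b` — for ANY
distinguisher class `𝒟` (any level `a`, `q = 0` or Boolean sums alike): the order-`k` shift-`τ`
shifted-partials method supplies no Boolean-sum witness for the crux at `(n, b)` once
`n ≥ max(k(τ+2k), (2k+2)²)`. [cite: ForbesShpilkaVolk2018, Def. 1] -/
theorem not_isNaturalProof_of_spRankSublevel {n b k τ e r : ℕ} (hb : 2 ≤ b) (hn : 6 ≤ n)
    (hk : 1 ≤ k) (he : τ + k ≤ e) (hdeg : k * (e + k) ≤ n) (hcost : 2 * k * (Nat.log 2 n + 1) ≤ n)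
    (𝒟 : Set (MvPolynomial (degLEMonomials n) ℂ)) (D : MvPolynomial (degLEMonomials n) ℂ)
    (hD : ∀ f : MvPolynomial (Fin n) ℂ, f.totalDegree ≤ n →
      (eval (coeffVector (degLEMonomials n) f) D = 0 ↔ shiftedPartialsRank ℂ k τ f < r)) :
    ¬ IsNaturalProof (degLEMonomials n) (SmallCircuits ℂ n b) 𝒟 D := by
  rintro ⟨-, hD0, hvan⟩
  exact hD0 (distinguisher_eq_zero_of_spRankSublevel hb hn hk he hdeg hcost D hD hvan)

/-- The `O(k·n·log n)`-size version: a `D` cutting out `{rank f_{(k,·)[τ]} < r}` and vanishing on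
`{deg ≤ n, L ≤ 2k·n·(⌊log₂ n⌋+1)}` (`n ≥ max(6, k(τ+2k))`) is the zero polynomial.
[cite: ForbesShpilkaVolk2018, Def. 1] -/
theorem distinguisher_eq_zero_of_spRankSublevel_knlogn {n k τ r : ℕ} (hn : 6 ≤ n) (hk : 1 ≤ k)
    (hcell : k * (τ + 2 * k) ≤ n) (D : MvPolynomial (degLEMonomials n) ℂ)
    (hD : ∀ f : MvPolynomial (Fin n) ℂ, f.totalDegree ≤ n →
      (eval (coeffVector (degLEMonomials n) f) D = 0 ↔ shiftedPartialsRank ℂ k τ f < r))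
    (hvan : ∀ f : MvPolynomial (Fin n) ℂ, f.totalDegree ≤ n →
      complexity f ≤ 2 * k * n * (Nat.log 2 n + 1) → eval (coeffVector (degLEMonomials n) f) D = 0) :
    D = 0 := by
  have hdeg : k * (τ + k + k) ≤ n := by rw [show τ + k + k = τ + 2 * k by ring]; exact hcell
  have hW : shiftedPartialsRank ℂ k τ (powerSumPowers ℂ n k (τ + k)) < r :=
    (hD _ ((totalDegree_powerSumPowers_le n k (τ + k)).trans hdeg)).1
      (hvan _ ((totalDegree_powerSumPowers_le n k (τ + k)).trans hdeg)
        (complexity_powerSumPowers_le' hn hk hdeg))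
  refine MvPolynomial.funext fun c => ?_
  obtain ⟨f, hfdeg, rfl⟩ := exists_coeffVector_eq c
  rw [map_zero]
  exact (hD f hfdeg).2 ((shiftedPartialsRank_le_powerSumPowers hk le_rfl f).trans_lt hW)

end FSV

end PartialDerivativeWall

end Summit.ValiantsHypothesis.ValiantsHypothesis.Theorems.BarrierLeverDefinableEquations
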